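import Summits.AtomisticToContinuum.BoseEinsteinCondensation.Theorems.BECCutLineWeakDisorderTwoReplicaTransienceBoundInsertionGeneric
import Summits.AtomisticToContinuum.BoseEinsteinCondensation.Theorems.TwoReplicaTransienceBound.Negative.ConstantAtLeastOne
import Literature.Probability.Process.BrownianRunningSupFourthMoment
import HarnessLib

/-!
# Crux `TwoReplicaTransienceBound` (stmt-AtomisticToContinuum-9687), line `SketchIdeator1` v6:
# the INSERTION STEP for every finite-range pair potential (stub `stub_insertionStep`)

Support file (`--supports stmt-AtomisticToContinuum-9687`, lead c3). At a fixed box `Λ_L` and polymer length,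
inserting one more world-line into the killed, interaction-weighted `(n+1)`-line system costs at most a
Wiener-sausage volume:

`Θ · N_{n+1} ≤ N_{n+2} + (n+1) · |Λ_L| · K · N_n`,

`N_k = ‖e^{-TH_k}1‖₂² = ∫ Z^{(k)}_{2T}` (`fkNormSq_eq`), `Θ = ‖e^{-TΔ_D}1‖₂²` (one free line),
`K = E_{ω₀,ω}[(2(R + √2(S(ω₀)+S(ω))))³]`, `S` = sum of the three coordinate running suprema on `[0, 2T]`
(finite: `stub_sausageMoment`). This is `insertion_generic` (…InsertionGeneric.lean) with the SAUSAGE penalty: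
by finite range `R`, if no bath line starts within `R + √2(S(ω₀) + S(ωbⱼ))` of `x` then the tagged–bath action
vanishes (`taggedBathAction_eq_zero_of_far`: displacement `‖√2 b_s‖ ≤ √2 S`), so
`1 ≤ e^{-(action)} + Σⱼ 𝟙{dist(x,Yⱼ) ≤ R + √2(S(ω₀)+S(ωbⱼ))}`; the `y`-volume of that ball is `≤ (2r)³`
(`|B₁| = 4π/3 ≤ 8`). Hard cores are allowed (no `‖v‖_∞`, no `‖v‖₁`): only the range enters.
-/

noncomputable section

open MeasureTheory Filter Set
open scoped ENNReal NNReal Topology BigOperators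

namespace Summit.AtomisticToContinuum.BoseEinsteinCondensation.Cruxes.TwoReplicaTransienceBound.Insertion

open Literature.MathematicalPhysics.QuantumManyBody.BoseGas
open Literature.Probability.Process (brownian runSup runSup_nonneg measurable_runSup abs_brownian_le_runSup)
open Summit.AtomisticToContinuum.BoseEinsteinCondensation.Cruxes.TwoReplicaTransienceBound.TracerDecoupling
open TracerFactorisation TracerMeasurability

variable {n N : ℕ}

/-! ### The sausage penalty: finite range ⇒ no action without reach -/

/-- The displacement of a world-line on `[0, h]` is at most `√2 ×` the sum of its three coordinate running
suprema: `‖√2 b_s‖ ≤ √2 Σ_k sup_{u ≤ h} |b^k_u|` for `s ≤ h`. -/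
theorem norm_toLp_brownian_le (ω : Fin 3 → (ℝ≥0 → ℝ)) {h s : ℝ≥0} (hs : s ≤ h) :
    ‖WithLp.toLp 2 (fun k : Fin 3 => Real.sqrt 2 * brownian s (ω k))‖ ≤ Real.sqrt 2 * ∑ k, runSup h (ω k) := by
  have h2 : 0 ≤ Real.sqrt 2 := Real.sqrt_nonneg 2
  have hsq2 : Real.sqrt 2 ^ 2 = 2 := Real.sq_sqrt (by norm_num)
  have hb : ∀ k, |brownian s (ω k)| ≤ runSup h (ω k) := fun k => abs_brownian_le_runSup hs (ω k)
  have hM : ∀ k, 0 ≤ runSup h (ω k) := fun k => runSup_nonneg h (ω k)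
  have hS : 0 ≤ Real.sqrt 2 * ∑ k, runSup h (ω k) := mul_nonneg h2 (Finset.sum_nonneg fun k _ => hM k)
  rw [EuclideanSpace.norm_eq, Real.sqrt_le_left hS]
  simp only [Real.norm_eq_abs, Fin.sum_univ_three, abs_mul, abs_of_nonneg h2]
  have h0 := hb 0; have h1 := hb 1; have h2' := hb 2
  have m0 := hM 0; have m1 := hM 1; have m2 := hM 2
  have a0 := abs_nonneg (brownian s (ω 0)); have a1 := abs_nonneg (brownian s (ω 1))
  have a2 := abs_nonneg (brownian s (ω 2))
  nlinarith [mul_le_mul h0 h0 a0 m0, mul_le_mul h1 h1 a1 m1, mul_le_mul h2' h2' a2 m2,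
    mul_nonneg m0 m1, mul_nonneg m0 m2, mul_nonneg m1 m2]

/-- Two displaced points stay at distance `≥ dist x y - ‖a‖ - ‖b‖`. -/
theorem dist_add_add_ge (x y a b : Space) : dist x y - ‖a‖ - ‖b‖ ≤ dist (x + a) (y + b) := by
  have h1 : dist x y ≤ dist x (x + a) + dist (x + a) (y + b) + dist (y + b) y := dist_triangle4 x (x + a) (y + b) y
  rw [dist_comm x (x + a), dist_eq_norm (x + a) x, add_sub_cancel_left, dist_eq_norm (y + b) y,
    add_sub_cancel_left] at h1
  linarith

/-- **Finite range: if no bath line starts within reach of the tagged line, the tagged–bath action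
vanishes.** With `S(ω) = Σ_k runSup t⁺ (ω k)`: if `dist x Yⱼ > R + √2 (S(ω₀) + S(ωbⱼ))` for every `j`, then
at every time `s ∈ (0, t]` the tagged line (from `x`) and line `j` (from `Yⱼ`) are more than `R` apart, so
`v = 0` there (`v` vanishes beyond `R`) and `∫₀ᵗ Σⱼ v = 0`. -/
theorem taggedBathAction_eq_zero_of_far {m : ℕ} {v : ℝ → ℝ≥0∞} {R : ℝ} (hR : ∀ r, R < r → v r = 0) (t : ℝ)
    (x : Space) (Y : Config m) (ω₀ : Fin 3 → (ℝ≥0 → ℝ)) (ωb : PathSpace m)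
    (hfar : ∀ j, R + Real.sqrt 2 * ((∑ k, runSup t.toNNReal (ω₀ k)) + ∑ k, runSup t.toNNReal (ωb j k)) <
      dist x (Y j)) :
    taggedBathAction v t x Y ω₀ ωb = 0 := by
  unfold taggedBathAction
  refine setLIntegral_eq_zero measurableSet_Ioc fun s hs => ?_
  simp only [Pi.zero_apply]
  refine Finset.sum_eq_zero fun j _ => hR _ ?_
  have hsle : s.toNNReal ≤ t.toNNReal := Real.toNNReal_le_toNNReal hs.2
  rw [worldLine_vecCons_cons_zero, worldLine_vecCons_cons_succ]
  have hj : worldLine Y ωb s.toNNReal j =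
      Y j + WithLp.toLp 2 (fun k : Fin 3 => Real.sqrt 2 * brownian s.toNNReal (ωb j k)) := rfl
  rw [hj]
  have ha := norm_toLp_brownian_le ω₀ hsle
  have hb := norm_toLp_brownian_le (ωb j) hsle
  have hd := dist_add_add_ge x (Y j) (WithLp.toLp 2 (fun k : Fin 3 => Real.sqrt 2 * brownian s.toNNReal (ω₀ k)))
    (WithLp.toLp 2 (fun k : Fin 3 => Real.sqrt 2 * brownian s.toNNReal (ωb j k)))
  have hf := hfar j
  rw [mul_add] at hf
  linarith

/-- **The sausage penalty dominates the tagged–bath Boltzmann factor**: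
`1 ≤ e^{-(tagged–bath action)} + Σⱼ 𝟙{dist(x, Yⱼ) ≤ R + √2(S(ω₀) + S(ωbⱼ))}` (either some line starts within
reach, or the action vanishes by `taggedBathAction_eq_zero_of_far`). -/
theorem one_le_expNeg_add_sum_sausage {m : ℕ} {v : ℝ → ℝ≥0∞} {R : ℝ} (hR : ∀ r, R < r → v r = 0) (t : ℝ)
    (x : Space) (Y : Config m) (ω₀ : Fin 3 → (ℝ≥0 → ℝ)) (ωb : PathSpace m) :
    1 ≤ expNeg (taggedBathAction v t x Y ω₀ ωb) +
      ∑ j, (Metric.closedBall x (R + Real.sqrt 2 *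
        ((∑ k, runSup t.toNNReal (ω₀ k)) + ∑ k, runSup t.toNNReal (ωb j k)))).indicator
          (fun _ => (1 : ℝ≥0∞)) (Y j) := by
  by_cases h : ∃ j, Y j ∈ Metric.closedBall x (R + Real.sqrt 2 *
      ((∑ k, runSup t.toNNReal (ω₀ k)) + ∑ k, runSup t.toNNReal (ωb j k)))
  · obtain ⟨j, hj⟩ := h
    have h1 : (Metric.closedBall x (R + Real.sqrt 2 *
        ((∑ k, runSup t.toNNReal (ω₀ k)) + ∑ k, runSup t.toNNReal (ωb j k)))).indicator
          (fun _ => (1 : ℝ≥0∞)) (Y j) = 1 := Set.indicator_of_mem hj _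
    calc (1 : ℝ≥0∞) = _ := h1.symm
      _ ≤ ∑ j, (Metric.closedBall x (R + Real.sqrt 2 *
          ((∑ k, runSup t.toNNReal (ω₀ k)) + ∑ k, runSup t.toNNReal (ωb j k)))).indicator
            (fun _ => (1 : ℝ≥0∞)) (Y j) :=
        Finset.single_le_sum (f := fun j => (Metric.closedBall x (R + Real.sqrt 2 *
          ((∑ k, runSup t.toNNReal (ω₀ k)) + ∑ k, runSup t.toNNReal (ωb j k)))).indicator
            (fun _ => (1 : ℝ≥0∞)) (Y j)) (fun _ _ => bot_le) (Finset.mem_univ j)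
      _ ≤ _ := le_add_self
  · push Not at h
    have hfar : ∀ j, R + Real.sqrt 2 * ((∑ k, runSup t.toNNReal (ω₀ k)) + ∑ k, runSup t.toNNReal (ωb j k)) <
        dist x (Y j) := fun j => by
      have := h j
      rw [Metric.mem_closedBall, not_le, dist_comm] at this
      exact this
    rw [taggedBathAction_eq_zero_of_far hR t x Y ω₀ ωb hfar, expNeg_zero]
    exact le_self_add

/-- The sum of the three coordinate running suprema is measurable in the sample. -/
theorem measurable_sum_runSup (h : ℝ≥0) : Measurable fun ω : Fin 3 → (ℝ≥0 → ℝ) => ∑ k, runSup h (ω k) :=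
  Finset.measurable_sum _ fun k _ => (measurable_runSup h).comp (measurable_pi_apply k)

/-- **Joint measurability of the sausage penalty** `(x, ω₀, y, ω) ↦ 𝟙{dist(x,y) ≤ R + √2(S(ω₀)+S(ω))}`. -/
theorem measurable_sausagePenalty (R : ℝ) (h : ℝ≥0) :
    Measurable fun q : (Space × (Fin 3 → (ℝ≥0 → ℝ))) × (Space × (Fin 3 → (ℝ≥0 → ℝ))) =>
      (Metric.closedBall q.1.1 (R + Real.sqrt 2 * ((∑ k, runSup h (q.1.2 k)) + ∑ k, runSup h (q.2.2 k)))).indicator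
        (fun _ => (1 : ℝ≥0∞)) q.2.1 := by
  have hr : Measurable fun q : (Space × (Fin 3 → (ℝ≥0 → ℝ))) × (Space × (Fin 3 → (ℝ≥0 → ℝ))) =>
      R + Real.sqrt 2 * ((∑ k, runSup h (q.1.2 k)) + ∑ k, runSup h (q.2.2 k)) :=
    measurable_const.add (measurable_const.mul
      (((measurable_sum_runSup h).comp (measurable_snd.comp measurable_fst)).add
        ((measurable_sum_runSup h).comp (measurable_snd.comp measurable_snd))))
  have hd : Measurable fun q : (Space × (Fin 3 → (ℝ≥0 → ℝ))) × (Space × (Fin 3 → (ℝ≥0 → ℝ))) =>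
      dist q.2.1 q.1.1 := (measurable_fst.comp measurable_snd).dist (measurable_fst.comp measurable_fst)
  have heq : (fun q : (Space × (Fin 3 → (ℝ≥0 → ℝ))) × (Space × (Fin 3 → (ℝ≥0 → ℝ))) =>
      (Metric.closedBall q.1.1 (R + Real.sqrt 2 * ((∑ k, runSup h (q.1.2 k)) + ∑ k, runSup h (q.2.2 k)))).indicator
        (fun _ => (1 : ℝ≥0∞)) q.2.1) =
      {q : (Space × (Fin 3 → (ℝ≥0 → ℝ))) × (Space × (Fin 3 → (ℝ≥0 → ℝ))) |
        dist q.2.1 q.1.1 ≤ R + Real.sqrt 2 * ((∑ k, runSup h (q.1.2 k)) + ∑ k, runSup h (q.2.2 k))}.indicator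
        fun _ => (1 : ℝ≥0∞) := by
    funext q
    by_cases hq : dist q.2.1 q.1.1 ≤ R + Real.sqrt 2 * ((∑ k, runSup h (q.1.2 k)) + ∑ k, runSup h (q.2.2 k))
    · rw [Set.indicator_of_mem (Metric.mem_closedBall.2 hq), Set.indicator_of_mem (by exact hq)]
    · have hq' : q ∉ {q : (Space × (Fin 3 → (ℝ≥0 → ℝ))) × (Space × (Fin 3 → (ℝ≥0 → ℝ))) |
          dist q.2.1 q.1.1 ≤ R + Real.sqrt 2 * ((∑ k, runSup h (q.1.2 k)) + ∑ k, runSup h (q.2.2 k))} := hq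
      rw [Set.indicator_of_notMem (fun h' => hq (Metric.mem_closedBall.1 h')), Set.indicator_of_notMem hq']
  rw [heq]
  exact measurable_const.indicator (measurableSet_le hd hr)

/-- **Volume of the reach ball**: `|B(x, r)| ≤ (2r)³` in `ℝ³` for `r ≥ 0` (`|B₁| = 4π/3 ≤ 8`). -/
theorem volume_closedBall_le (x : Space) {r : ℝ} (hr : 0 ≤ r) :
    volume (Metric.closedBall x r) ≤ ENNReal.ofReal ((2 * r) ^ 3) := by
  rw [EuclideanSpace.volume_closedBall_fin_three, ← ENNReal.ofReal_pow hr]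
  have hπ : Real.pi * 4 / 3 ≤ 8 := by linarith [Real.pi_le_four]
  calc ENNReal.ofReal (r ^ 3) * ENNReal.ofReal (Real.pi * 4 / 3)
      ≤ ENNReal.ofReal (r ^ 3) * ENNReal.ofReal 8 := mul_le_mul' le_rfl (ENNReal.ofReal_le_ofReal hπ)
    _ = ENNReal.ofReal ((2 * r) ^ 3) := by
        rw [← ENNReal.ofReal_mul (pow_nonneg hr 3)]
        congr 1; ring

/-- **The tagged-point error functional is bounded by the cubic sausage moment**: for every `x`,
`∫ dy ∫ dW(ω) ∫ dW(ω₀) 𝟙{dist(x,y) ≤ r(ω₀,ω)} ≤ E_{ω₀,ω}[(2 r(ω₀,ω))³]`, `r = R + √2(S(ω₀)+S(ω))` (Tonelli to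
integrate `y` first; ball volume). -/
theorem lintegral_sausagePenalty_le {R : ℝ} (hR : 0 ≤ R) (h : ℝ≥0) (x : Space) :
    ∫⁻ y, ∫⁻ ω, ∫⁻ ω₀, (Metric.closedBall x (R + Real.sqrt 2 * ((∑ k, runSup h (ω₀ k)) + ∑ k, runSup h (ω k)))).indicator
        (fun _ => (1 : ℝ≥0∞)) y ∂wienerLine ∂wienerLine ≤
      ∫⁻ ω₀, ∫⁻ ω, ENNReal.ofReal ((2 * (R + Real.sqrt 2 *
          ((∑ k, runSup h (ω₀ k)) + ∑ k, runSup h (ω k)))) ^ 3) ∂wienerLine ∂wienerLine := by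
  have hP := measurable_sausagePenalty R h
  -- nonnegativity of the radius
  have hrad : ∀ ω₀ ω : Fin 3 → (ℝ≥0 → ℝ), 0 ≤ R + Real.sqrt 2 * ((∑ k, runSup h (ω₀ k)) + ∑ k, runSup h (ω k)) :=
    fun ω₀ ω => add_nonneg hR (mul_nonneg (Real.sqrt_nonneg 2) (add_nonneg
      (Finset.sum_nonneg fun k _ => runSup_nonneg h (ω₀ k)) (Finset.sum_nonneg fun k _ => runSup_nonneg h (ω k))))
  -- measurability of the sections needed for the two Tonelli swaps
  have hF1 : Measurable fun q : Space × (Fin 3 → (ℝ≥0 → ℝ)) => ∫⁻ ω₀, (Metric.closedBall x (R + Real.sqrt 2 *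
      ((∑ k, runSup h (ω₀ k)) + ∑ k, runSup h (q.2 k)))).indicator (fun _ => (1 : ℝ≥0∞)) q.1 ∂wienerLine := by
    have h3 : Measurable fun q : (Space × (Fin 3 → (ℝ≥0 → ℝ))) × (Fin 3 → (ℝ≥0 → ℝ)) =>
        (Metric.closedBall x (R + Real.sqrt 2 * ((∑ k, runSup h (q.2 k)) + ∑ k, runSup h (q.1.2 k)))).indicator
          (fun _ => (1 : ℝ≥0∞)) q.1.1 := by
      have hc := hP.comp (f := fun q : (Space × (Fin 3 → (ℝ≥0 → ℝ))) × (Fin 3 → (ℝ≥0 → ℝ)) => ((x, q.2), q.1))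
        ((measurable_const.prodMk measurable_snd).prodMk measurable_fst)
      exact hc
    exact h3.lintegral_prod_right'
  have hF2 : ∀ ω : Fin 3 → (ℝ≥0 → ℝ), Measurable fun q : Space × (Fin 3 → (ℝ≥0 → ℝ)) =>
      (Metric.closedBall x (R + Real.sqrt 2 * ((∑ k, runSup h (q.2 k)) + ∑ k, runSup h (ω k)))).indicator
        (fun _ => (1 : ℝ≥0∞)) q.1 := by
    intro ω
    have hc := hP.comp (f := fun q : Space × (Fin 3 → (ℝ≥0 → ℝ)) => ((x, q.2), (q.1, ω)))
      ((measurable_const.prodMk measurable_snd).prodMk (measurable_fst.prodMk measurable_const))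
    exact hc
  rw [lintegral_lintegral_swap hF1.aemeasurable]
  refine (lintegral_mono fun ω => (lintegral_lintegral_swap (hF2 ω).aemeasurable).le).trans ?_
  -- integrate `y` first: the ball volume
  have hball : ∀ ω₀ ω : Fin 3 → (ℝ≥0 → ℝ),
      ∫⁻ y, (Metric.closedBall x (R + Real.sqrt 2 * ((∑ k, runSup h (ω₀ k)) + ∑ k, runSup h (ω k)))).indicator
        (fun _ => (1 : ℝ≥0∞)) y ≤
      ENNReal.ofReal ((2 * (R + Real.sqrt 2 * ((∑ k, runSup h (ω₀ k)) + ∑ k, runSup h (ω k)))) ^ 3) := by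
    intro ω₀ ω
    rw [lintegral_indicator Metric.isClosed_closedBall.measurableSet, setLIntegral_const, one_mul]
    exact volume_closedBall_le x (hrad ω₀ ω)
  calc ∫⁻ ω, ∫⁻ ω₀, ∫⁻ y, (Metric.closedBall x (R + Real.sqrt 2 * ((∑ k, runSup h (ω₀ k)) + ∑ k, runSup h (ω k)))).indicator
          (fun _ => (1 : ℝ≥0∞)) y ∂volume ∂wienerLine ∂wienerLine
      ≤ ∫⁻ ω, ∫⁻ ω₀, ENNReal.ofReal ((2 * (R + Real.sqrt 2 *
          ((∑ k, runSup h (ω₀ k)) + ∑ k, runSup h (ω k)))) ^ 3) ∂wienerLine ∂wienerLine :=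
        lintegral_mono fun ω => lintegral_mono fun ω₀ => hball ω₀ ω
    _ = _ := by
        -- rename the two samples (the integrand is symmetric in them)
        refine lintegral_congr fun ω => lintegral_congr fun ω₀ => ?_
        rw [add_comm (∑ k, runSup h (ω₀ k)) (∑ k, runSup h (ω k))]

/-- `‖e^{-TH_N}1‖₂² = ∫ Z^{(N)}_{2T}` (symmetry and the semigroup law, `fkNormSq_eq`). -/
theorem fkNormSq_one_eq_lintegral_fkPartition {v : ℝ → ℝ≥0∞} (hv : Measurable v) (L : ℝ) {T : ℝ} (hT : 0 ≤ T) :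
    fkNormSq (N := N) v L T (fun _ => (1 : ℝ≥0∞)) = ∫⁻ X : Config N, fkPartition v L (2 * T) X := by
  rw [fkNormSq_eq hv L hT measurable_const]
  simp only [one_mul]
  rfl

end Summit.AtomisticToContinuum.BoseEinsteinCondensation.Cruxes.TwoReplicaTransienceBound.Insertion

namespace Summit.AtomisticToContinuum.BoseEinsteinCondensation.Cruxes.TwoReplicaTransienceBound.TracerDecoupling

open Literature.MathematicalPhysics.QuantumManyBody.BoseGas
open Literature.Probability.Process (runSup runSup_nonneg)
open Summit.AtomisticToContinuum.BoseEinsteinCondensation.Cruxes.TwoReplicaTransienceBound.Insertion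

/-- **Registered stub `stub_insertionStep`** (crux stmt-AtomisticToContinuum-9687, line `SketchIdeator1` v6): the
insertion step `Θ·N_{n+1} ≤ N_{n+2} + (n+1)·|Λ_L|·K_T·N_n` for EVERY finite-range pair potential (hard cores
allowed), at a fixed box and polymer length — `insertion_generic` with the sausage penalty
(`one_le_expNeg_add_sum_sausage`, `lintegral_sausagePenalty_le`), `|Λ_L| = L³`, and
`‖e^{-TH}1‖₂² = ∫Z_{2T}` (`fkNormSq_one_eq_lintegral_fkPartition`). -/
theorem stub_insertionStep :
    ∀ (n : ℕ) (v : ℝ → ENNReal), Measurable v → ∀ (R : ℝ), 0 ≤ R → (∀ r, R < r → v r = 0) →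
      ∀ (L T : ℝ), 0 < L → 0 ≤ T →
        @fkNormSq 1 (fun _ => 0) L T (fun _ => (1 : ENNReal)) *
            @fkNormSq (n + 1) v L T (fun _ => (1 : ENNReal)) ≤
          @fkNormSq (n + 2) v L T (fun _ => (1 : ENNReal)) +
            ((n : ENNReal) + 1) * ENNReal.ofReal (L ^ 3) *
              (∫⁻ ω₀, ∫⁻ ω, ENNReal.ofReal ((2 * (R + Real.sqrt 2 *
                  ((∑ k, runSup (2 * T).toNNReal (ω₀ k)) + ∑ k, runSup (2 * T).toNNReal (ω k)))) ^ 3)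
                ∂wienerLine ∂wienerLine) *
              @fkNormSq n v L T (fun _ => (1 : ENNReal)) := by
  intro n v hv R hR hvR L T hL hT
  have h2T : 0 ≤ 2 * T := by linarith
  -- the generic inequality at polymer length `2T` with the sausage penalty
  have hgen := insertion_generic (n := n) hv L h2T
    (fun x ω₀ y ω => (Metric.closedBall x (R + Real.sqrt 2 *
      ((∑ k, runSup (2 * T).toNNReal (ω₀ k)) + ∑ k, runSup (2 * T).toNNReal (ω k)))).indicator
        (fun _ => (1 : ℝ≥0∞)) y)
    (measurable_sausagePenalty R (2 * T).toNNReal)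
    (fun x ω₀ Y ωb => one_le_expNeg_add_sum_sausage hvR (2 * T) x Y ω₀ ωb)
  -- the norms as `2T`-long partition integrals
  have hΘ : @fkNormSq 1 (fun _ => 0) L T (fun _ => (1 : ENNReal)) =
      ∫⁻ x, fkPartition (N := 1) (fun _ => 0) L (2 * T) (fun _ => x) := by
    rw [fkNormSq_one_eq_lintegral_fkPartition measurable_const L hT, FreeGas.lintegral_config_one]
  rw [hΘ, fkNormSq_one_eq_lintegral_fkPartition hv L hT, fkNormSq_one_eq_lintegral_fkPartition hv L hT,
    fkNormSq_one_eq_lintegral_fkPartition hv L hT]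
  refine hgen.trans (add_le_add le_rfl ?_)
  -- the error coefficient: `∫_{x ∈ Λ} G ≤ |Λ| · K`
  rw [mul_assoc ((n : ℝ≥0∞) + 1) (ENNReal.ofReal (L ^ 3))]
  refine mul_le_mul' (mul_le_mul' le_rfl ?_) le_rfl
  calc ∫⁻ x in box L, ∫⁻ y, ∫⁻ ω, ∫⁻ ω₀, (Metric.closedBall x (R + Real.sqrt 2 *
          ((∑ k, runSup (2 * T).toNNReal (ω₀ k)) + ∑ k, runSup (2 * T).toNNReal (ω k)))).indicator
            (fun _ => (1 : ℝ≥0∞)) y ∂wienerLine ∂wienerLine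
      ≤ ∫⁻ _x in box L, ∫⁻ ω₀, ∫⁻ ω, ENNReal.ofReal ((2 * (R + Real.sqrt 2 *
          ((∑ k, runSup (2 * T).toNNReal (ω₀ k)) + ∑ k, runSup (2 * T).toNNReal (ω k)))) ^ 3)
            ∂wienerLine ∂wienerLine :=
        lintegral_mono fun x => lintegral_sausagePenalty_le hR _ x
    _ = _ := by
        rw [setLIntegral_const, volume_box, ← ENNReal.ofReal_pow hL.le, mul_comm]

end Summit.AtomisticToContinuum.BoseEinsteinCondensation.Cruxes.TwoReplicaTransienceBound.TracerDecoupling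

end
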